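import Summits.QuantumFields.YangMills.Theorems.AllWindowsColdBoxBoxHighLineSmearedFPOperatorPerturbation
import Summits.QuantumFields.YangMills.Theorems.AllWindowsColdBoxBoxHighLineSmearedFPPauli

/-!
# TASK T-S5/U5 step (1b): the BULK hypothesis (bulk-Φ) of the T-S5.4 spine — `|Φ(V^{exp iA}) − ‖F·♭A‖²| ≤ κ·|♭A|²`

LEAD sfw-p2 g77's routing (R5) of 2026-08-29T18:10:48Z, in the letters of the T-S5.4 builder fcl-p3 g25 (DISCHARGE MAP 18:08:16Z, 4k-G
`orbitNormaliser_upper/_lower`, hypothesis (bulk-Φ)): at a configuration `V` in lattice Landau gauge (`InLandauGauge H V`, i.e.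
`divDefect V = 0` at the interior sites), for Pauli coordinates `A` with `‖A x‖ ≤ s ≤ 1` at every interior site,

  `|landauPhi H (V^{pauliGauge H A}) − ‖fpOperator H V *ᵥ ♭A‖²| ≤ (10752·M + 28901376·s)·s · (♭A ⬝ᵥ ♭A)`,

where `♭A = fun q => A q.1 q.2` (= fcl-p3's `LaplaceSandwich.flatten _ A`, definitionally) and `M` is any ℓ²-operator bound of
`F = fpOperator H V` (`‖Fv‖² ≤ M²‖v‖²`, a HYPOTHESIS: Schur `≤ 16` at `F(1)` plus ✓4c-E `fpOperator_sub_one_opBound`).  So κ = O(ρ) with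
`s = √3ρ`, as the spine wants.  Ingredients: ✓4c analytic half `abs_divDefect_expPauli_sub_lin_le` (per site, local maximum
`m_x = min 1 √S′_x`, `S′_x = ‖a x‖² + Σ_μ (‖a(x+e_μ)‖² + ‖a(x−e_μ)‖²)`, `a = extPauli H A`), the neighbour count ✓`sum_interior_neighbours_le`
(`Σ_x S′_x ≤ 16 |♭A|²`), `fpOperator_mulVec`, and `Φ = Σ (L + R)²` with `|Σ(2LR + R²)| ≤ 2‖L‖‖R‖ + ‖R‖²`, `‖R‖ ≤ 5376·s·|♭A|`.

HONEST LABEL: one hypothesis of the T-S5.4 spine discharged; T-S5.4 proper, S5, U5, ⟨24004⟩ ⟨24335⟩ ⟨24336⟩ remain OPEN; no crux, rung or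
summit is proved; the Yang–Mills mass gap is NOT proved by this file.
-/

set_option autoImplicit false

noncomputable section

open Matrix Finset
open Literature.MathematicalPhysics.QuantumFieldTheory.Balaban1983to89.B10Eq18SigmaSU2Haar (expPauli)
open Literature.MathematicalPhysics.QuantumFieldTheory.AxialGauge (boxEdges)
open Literature.MathematicalPhysics.QuantumLattice (LGConfig ZdEdge gaugeTransformZd)
open Literature.Probability.LatticeModels (Site)

namespace Summit.QuantumFields.YangMills.Theorems.AllWindowsColdBoxBoxHighLine

/-- `Φ` as a sum over the index type `interiorSites H × Fin 3`. -/
theorem landauPhi_eq_sum_fintype (H : ℕ) (U : LGConfig 4 SU2) :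
    landauPhi H U = ∑ p : ↥(interiorSites H) × Fin 3, divDefect U p.1 p.2 ^ 2 := by
  rw [landauPhi, Fintype.sum_prod_type, ← Finset.sum_coe_sort (interiorSites H)]

/-- At a Landau-gauge configuration the divergence defect vanishes at every interior site. -/
theorem divDefect_eq_zero_of_inLandauGauge {H : ℕ} {V : LGConfig 4 SU2} (hV : InLandauGauge H V) (x : ↥(interiorSites H)) (c : Fin 3) :
    divDefect V x c = 0 := by
  have h := (landau_at_iff_divDefect_eq_zero V x).1 (hV x x.2)
  exact congrFun h c

/-- Square-summable control of a sum of squares: if `|R_p| ≤ 256·S_p`, `|R_p| ≤ 256·t` and `Σ S ≤ B`, then `Σ R² ≤ 256²·t·B`-type bound.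
Here in the concrete form used below. -/
theorem abs_sum_sq_sub_sq_le {ι : Type*} [Fintype ι] (L R : ι → ℝ) {a b : ℝ} (ha : 0 ≤ a) (hb : 0 ≤ b)
    (hL : ∑ p, L p ^ 2 ≤ a ^ 2) (hR : ∑ p, R p ^ 2 ≤ b ^ 2) :
    |∑ p, (L p + R p) ^ 2 - ∑ p, L p ^ 2| ≤ 2 * a * b + b ^ 2 := by
  have hcs : (∑ p, L p * R p) ^ 2 ≤ (∑ p, L p ^ 2) * ∑ p, R p ^ 2 := by
    simpa only [sq] using Finset.sum_mul_sq_le_sq_mul_sq Finset.univ L R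
  have hLR : |∑ p, L p * R p| ≤ a * b := by
    have h1 : (∑ p, L p * R p) ^ 2 ≤ (a * b) ^ 2 := by
      rw [mul_pow]; exact hcs.trans (mul_le_mul hL hR (Finset.sum_nonneg fun p _ => sq_nonneg _) (sq_nonneg a))
    exact abs_le_of_sq_le_sq' h1 (mul_nonneg ha hb) |> fun h => abs_le.2 h
  have hexp : ∑ p, (L p + R p) ^ 2 - ∑ p, L p ^ 2 = 2 * ∑ p, L p * R p + ∑ p, R p ^ 2 := by
    rw [Finset.mul_sum, ← Finset.sum_add_distrib, ← Finset.sum_sub_distrib]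
    exact Finset.sum_congr rfl fun p _ => by ring
  rw [hexp]
  calc |2 * ∑ p, L p * R p + ∑ p, R p ^ 2| ≤ |2 * ∑ p, L p * R p| + |∑ p, R p ^ 2| := abs_add_le _ _
    _ ≤ 2 * (a * b) + b ^ 2 := by
        rw [abs_mul, abs_two, abs_of_nonneg (Finset.sum_nonneg fun p _ => sq_nonneg (R p))]
        exact add_le_add (mul_le_mul_of_nonneg_left hLR (by norm_num)) hR
    _ = 2 * a * b + b ^ 2 := by ring
set_option maxHeartbeats 400000 in
/-- **(bulk-Φ).**  At a Landau-gauge `V`, with an ℓ²-operator bound `M` for `F = fpOperator H V` and Pauli coordinates of sup-size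
`≤ s ≤ 1`: `|Φ(V^{pauliGauge A}) − ‖F ♭A‖²| ≤ (10752·M + 28901376·s)·s·|♭A|²`. -/
theorem bulkPhi (H : ℕ) (V : LGConfig 4 SU2) (hV : InLandauGauge H V) {M s : ℝ} (hM0 : 0 ≤ M) (hs0 : 0 ≤ s) (hs1 : s ≤ 1)
    (hF : ∀ v : ↥(interiorSites H) × Fin 3 → ℝ, (fpOperator H V *ᵥ v) ⬝ᵥ (fpOperator H V *ᵥ v) ≤ M ^ 2 * (v ⬝ᵥ v))
    (A : ↥(interiorSites H) → EuclideanSpace ℝ (Fin 3)) (hA : ∀ x, ‖A x‖ ≤ s) :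
    |landauPhi H (gaugeTransformZd (pauliGauge H A) V) -
        (fpOperator H V *ᵥ fun q : ↥(interiorSites H) × Fin 3 => A q.1 q.2) ⬝ᵥ
          (fpOperator H V *ᵥ fun q : ↥(interiorSites H) × Fin 3 => A q.1 q.2)| ≤
      (10752 * M + 28901376 * s) * s * ((fun q : ↥(interiorSites H) × Fin 3 => A q.1 q.2) ⬝ᵥ fun q => A q.1 q.2) := by
  -- opaque abbreviations (no `set`: keeps `whnf` cheap)
  obtain ⟨v, hv⟩ : ∃ v : ↥(interiorSites H) × Fin 3 → ℝ, v = fun q => A q.1 q.2 := ⟨_, rfl⟩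
  obtain ⟨a, ha⟩ : ∃ a : Site 4 → EuclideanSpace ℝ (Fin 3), a = extPauli H A := ⟨_, rfl⟩
  obtain ⟨f, hf⟩ : ∃ f : Site 4 → ℝ, ∀ z, f z = ‖a z‖ ^ 2 := ⟨_, fun z => rfl⟩
  obtain ⟨S, hS⟩ : ∃ S : Site 4 → ℝ, ∀ x, S x = f x + ∑ μ : Fin 4, (f (x + Pi.single μ 1) + f (x - Pi.single μ 1)) :=
    ⟨_, fun x => rfl⟩
  obtain ⟨L, hL⟩ : ∃ L : ↥(interiorSites H) × Fin 3 → ℝ, ∀ p, L p = (fpOperator H V *ᵥ v) p := ⟨_, fun p => rfl⟩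
  obtain ⟨R, hR⟩ : ∃ R : ↥(interiorSites H) × Fin 3 → ℝ, ∀ p, R p = divDefect (gaugeTransformZd (pauliGauge H A) V) p.1 p.2 - L p :=
    ⟨_, fun p => rfl⟩
  rw [← hv]
  have hf0 : ∀ z, 0 ≤ f z := fun z => by rw [hf]; exact sq_nonneg _
  have hfI : ∀ z, z ∉ interiorSites H → f z = 0 := fun z hz => by rw [hf, ha, extPauli_of_not_mem _ hz, norm_zero]; ring
  have haz : ∀ z, ‖a z‖ ≤ s := by rw [ha]; exact norm_extPauli_le A hs0 hA
  have hvv : v ⬝ᵥ v = ∑ x ∈ interiorSites H, f x := by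
    have h1 := sum_norm_sq_extPauli_vecToField (H := H) v
    have h2 : vecToField H v = A := by rw [hv]; exact vecToField_coords A
    rw [h2, ← ha] at h1
    rw [← h1]
    exact Finset.sum_congr rfl fun x _ => (hf x).symm
  have hvv0 : 0 ≤ v ⬝ᵥ v := by rw [hvv]; exact Finset.sum_nonneg fun x _ => hf0 x
  have hS0 : ∀ x, 0 ≤ S x := fun x => by
    rw [hS]; exact add_nonneg (hf0 x) (Finset.sum_nonneg fun μ _ => add_nonneg (hf0 _) (hf0 _))
  have hfS : ∀ x, f x ≤ S x := fun x => by
    rw [hS]; exact le_add_of_nonneg_right (Finset.sum_nonneg fun μ _ => add_nonneg (hf0 _) (hf0 _))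
  have hfS' : ∀ x (μ : Fin 4), f (x + Pi.single μ 1) ≤ S x ∧ f (x - Pi.single μ 1) ≤ S x := by
    intro x μ
    have hμ : f (x + Pi.single μ 1) + f (x - Pi.single μ 1) ≤ ∑ ν : Fin 4, (f (x + Pi.single ν 1) + f (x - Pi.single ν 1)) :=
      Finset.single_le_sum (f := fun ν : Fin 4 => f (x + Pi.single ν 1) + f (x - Pi.single ν 1))
        (fun ν _ => add_nonneg (hf0 _) (hf0 _)) (Finset.mem_univ μ)
    have h1 := hf0 x
    have h2 := hf0 (x + Pi.single μ 1)
    have h3 := hf0 (x - Pi.single μ 1)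
    rw [hS]
    constructor <;> linarith
  have hSle : ∀ x, S x ≤ 9 * s ^ 2 := by
    intro x
    have h1 : ∀ z, f z ≤ s ^ 2 := fun z => by rw [hf]; exact pow_le_pow_left₀ (norm_nonneg _) (haz z) 2
    rw [hS]
    calc f x + ∑ μ : Fin 4, (f (x + Pi.single μ 1) + f (x - Pi.single μ 1)) ≤ s ^ 2 + ∑ _μ : Fin 4, (s ^ 2 + s ^ 2) :=
          add_le_add (h1 x) (Finset.sum_le_sum fun μ _ => add_le_add (h1 _) (h1 _))
      _ = 9 * s ^ 2 := by simp only [Finset.sum_const, Finset.card_univ, Fintype.card_fin, nsmul_eq_mul]; push_cast; ring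
  have hSsum : ∑ x ∈ interiorSites H, S x ≤ 16 * (v ⬝ᵥ v) := by
    rw [hvv]
    refine le_trans (Finset.sum_le_sum fun x _ => ?_) (sum_interior_neighbours_le (H := H) f hf0 hfI)
    rw [hS, Finset.sum_add_distrib]
    have h1 := hf0 x
    have h2 : ∑ μ : Fin 4, (f (x - Pi.single μ 1) + f (x + Pi.single μ 1) + 2 * f x) =
        ∑ μ : Fin 4, f (x + Pi.single μ 1) + ∑ μ : Fin 4, f (x - Pi.single μ 1) + 8 * f x := by
      rw [Finset.sum_add_distrib, Finset.sum_add_distrib]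
      simp only [Finset.sum_const, Finset.card_univ, Fintype.card_fin, nsmul_eq_mul]
      push_cast; ring
    rw [h2]; linarith
  -- per-site remainder
  have hW : gaugeTransformZd (pauliGauge H A) V = gaugeTransformZd (fun z => expPauli (a z)) V := by
    rw [pauliGauge, ha, extendGauge_expPauli]
  have hRp : ∀ p : ↥(interiorSites H) × Fin 3, R p ^ 2 ≤ 256 ^ 2 * (9 * s ^ 2) * S p.1 := by
    intro p
    obtain ⟨m, hm⟩ : ∃ m : ℝ, m = min 1 (Real.sqrt (S p.1)) := ⟨_, rfl⟩
    have hm1 : m ≤ 1 := by rw [hm]; exact min_le_left _ _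
    have hm0 : 0 ≤ m := by rw [hm]; exact le_min zero_le_one (Real.sqrt_nonneg _)
    have hle : ∀ z, f z ≤ S p.1 → ‖a z‖ ≤ m := by
      intro z hz
      rw [hm]
      refine le_min ((haz z).trans hs1) ?_
      calc ‖a z‖ = Real.sqrt (f z) := by rw [hf]; exact (Real.sqrt_sq (norm_nonneg _)).symm
        _ ≤ Real.sqrt (S p.1) := Real.sqrt_le_sqrt hz
    have hx : ‖a (p.1 : Site 4)‖ ≤ m := hle _ (hfS _)
    have hnb : ∀ μ : Fin 4, ‖a ((p.1 : Site 4) + Pi.single μ 1)‖ ≤ m ∧ ‖a ((p.1 : Site 4) - Pi.single μ 1)‖ ≤ m := fun μ =>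
      ⟨hle _ (hfS' _ μ).1, hle _ (hfS' _ μ).2⟩
    have h := abs_divDefect_expPauli_sub_lin_le V a (p.1 : Site 4) hm1 hx hnb p.2
    have hdV : divDefect V (p.1 : Site 4) p.2 = 0 := divDefect_eq_zero_of_inLandauGauge hV p.1 p.2
    have hLp : L p = divDefectLin V a (p.1 : Site 4) p.2 := by
      rw [hL, fpOperator_mulVec, ha]
      have h2 : vecToField H v = A := by rw [hv]; exact vecToField_coords A
      rw [h2]
    have hRp' : R p = divDefect (gaugeTransformZd (fun z => expPauli (a z)) V) (p.1 : Site 4) p.2 - divDefect V (p.1 : Site 4) p.2 -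
        divDefectLin V a (p.1 : Site 4) p.2 := by
      rw [hR, hW, hdV, sub_zero, hLp]
    have hm2 : m ^ 2 ≤ S p.1 := by
      calc m ^ 2 ≤ Real.sqrt (S p.1) ^ 2 := pow_le_pow_left₀ hm0 (by rw [hm]; exact min_le_right _ _) 2
        _ = S p.1 := Real.sq_sqrt (hS0 _)
    have habs : |R p| ≤ 256 * m ^ 2 := by rw [hRp']; exact h
    have hSp := hSle (p.1 : Site 4)
    have hRabs0 : 0 ≤ |R p| := abs_nonneg _
    calc R p ^ 2 = |R p| * |R p| := by rw [← sq, sq_abs]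
      _ ≤ (256 * m ^ 2) * (256 * m ^ 2) := mul_le_mul habs habs hRabs0 (by positivity)
      _ = 256 ^ 2 * (m ^ 2) * (m ^ 2) := by ring
      _ ≤ 256 ^ 2 * (9 * s ^ 2) * S p.1 := by
          have := mul_le_mul (hm2.trans hSp) hm2 (sq_nonneg m) (by positivity)
          nlinarith
  -- global bounds
  have hRsum : ∑ p : ↥(interiorSites H) × Fin 3, R p ^ 2 ≤ (5376 * s * Real.sqrt (v ⬝ᵥ v)) ^ 2 := by
    have hw : Real.sqrt (v ⬝ᵥ v) ^ 2 = v ⬝ᵥ v := Real.sq_sqrt hvv0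
    calc ∑ p : ↥(interiorSites H) × Fin 3, R p ^ 2 ≤ ∑ p : ↥(interiorSites H) × Fin 3, 256 ^ 2 * (9 * s ^ 2) * S p.1 :=
          Finset.sum_le_sum fun p _ => hRp p
      _ = 3 * (256 ^ 2 * (9 * s ^ 2)) * ∑ x ∈ interiorSites H, S x := by
          rw [Fintype.sum_prod_type, ← Finset.sum_coe_sort (interiorSites H), Finset.mul_sum]
          refine Finset.sum_congr rfl fun y _ => ?_
          simp only [Finset.sum_const, Finset.card_univ, Fintype.card_fin, nsmul_eq_mul]
          push_cast; ring
      _ ≤ 3 * (256 ^ 2 * (9 * s ^ 2)) * (16 * (v ⬝ᵥ v)) := mul_le_mul_of_nonneg_left hSsum (by positivity)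
      _ ≤ (5376 * s * Real.sqrt (v ⬝ᵥ v)) ^ 2 := by rw [mul_pow, mul_pow, hw]; nlinarith
  have hLsum : ∑ p : ↥(interiorSites H) × Fin 3, L p ^ 2 ≤ (M * Real.sqrt (v ⬝ᵥ v)) ^ 2 := by
    have h1 := hF v
    rw [mul_pow, Real.sq_sqrt hvv0]
    have h2 : ∑ p : ↥(interiorSites H) × Fin 3, L p ^ 2 = (fpOperator H V *ᵥ v) ⬝ᵥ (fpOperator H V *ᵥ v) := by
      rw [dotProduct]; exact Finset.sum_congr rfl fun p _ => by rw [hL, sq]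
    rw [h2]; exact h1
  have ha0 : 0 ≤ M * Real.sqrt (v ⬝ᵥ v) := mul_nonneg hM0 (Real.sqrt_nonneg _)
  have hb0 : 0 ≤ 5376 * s * Real.sqrt (v ⬝ᵥ v) := mul_nonneg (mul_nonneg (by norm_num) hs0) (Real.sqrt_nonneg _)
  have hmain : |∑ p : ↥(interiorSites H) × Fin 3, (L p + R p) ^ 2 - ∑ p : ↥(interiorSites H) × Fin 3, L p ^ 2| ≤
      2 * (M * Real.sqrt (v ⬝ᵥ v)) * (5376 * s * Real.sqrt (v ⬝ᵥ v)) + (5376 * s * Real.sqrt (v ⬝ᵥ v)) ^ 2 :=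
    abs_sum_sq_sub_sq_le L R ha0 hb0 hLsum hRsum
  -- rewrite the goal in terms of `L`, `R`
  have hΦ : landauPhi H (gaugeTransformZd (pauliGauge H A) V) = ∑ p : ↥(interiorSites H) × Fin 3, (L p + R p) ^ 2 := by
    rw [landauPhi_eq_sum_fintype]
    exact Finset.sum_congr rfl fun p _ => by rw [hR]; ring
  have hFF : (fpOperator H V *ᵥ v) ⬝ᵥ (fpOperator H V *ᵥ v) = ∑ p : ↥(interiorSites H) × Fin 3, L p ^ 2 := by
    rw [dotProduct]; exact Finset.sum_congr rfl fun p _ => by rw [hL, sq]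
  rw [hΦ, hFF]
  have ht : Real.sqrt (v ⬝ᵥ v) * Real.sqrt (v ⬝ᵥ v) = v ⬝ᵥ v := Real.mul_self_sqrt hvv0
  calc |∑ p : ↥(interiorSites H) × Fin 3, (L p + R p) ^ 2 - ∑ p : ↥(interiorSites H) × Fin 3, L p ^ 2|
      ≤ 2 * (M * Real.sqrt (v ⬝ᵥ v)) * (5376 * s * Real.sqrt (v ⬝ᵥ v)) + (5376 * s * Real.sqrt (v ⬝ᵥ v)) ^ 2 := hmain
    _ = (10752 * M + 28901376 * s) * s * (Real.sqrt (v ⬝ᵥ v) * Real.sqrt (v ⬝ᵥ v)) := by ring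
    _ = (10752 * M + 28901376 * s) * s * (v ⬝ᵥ v) := by rw [ht]

end Summit.QuantumFields.YangMills.Theorems.AllWindowsColdBoxBoxHighLine

end
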